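/-
PORT (pub-hodgecm2, COR-CM cell) of the stage-1 package file `HodgeCMPerL/HodgeCM/Proofs/Landherr.lean`
(pub-hodgecm HOME/lean, bytes of record md5 c4fd529d9964, 135 lines). Declarations VERBATIM; edits: imports rewritten to tree
modules, namespace token `HodgeCM` ↦ `Summit.HodgeConjecture.CorCM`, package `conjRingHomK` ↦ tree `Literature.NumberTheory.Automorphic.cmConjRingHom`
(definitionally equal bodies), linter fixes. Generator: pub-hodgecm2-p1 `work/port/build_kit.py`.
-/
/-
Copyright: pub-hodgecm formalisation cell (harness21, 2026). New file (not vendored). Gen 3.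
-/
import Summits.HodgeConjecture.CorCM.Geometry.Statements
import Mathlib.NumberTheory.NumberField.Units.DirichletTheorem
import Literature.NumberTheory.NumberFields.CMFieldPrescribedSigns

/-!
# Landherr's existence theorem in rank 3 — PROOF of the stub `StubTree.landherr_exists`

`Universe.LandherrExists : ∀ (L : CMField) (ι₁ : L →+* ℂ), Nonempty (HermSpace3 L ι₁)`:
over every CM field `L` and for every complex embedding `ι₁` there is a hermitian 3-space of signature
`(2,1)` at the place of `ι₁` and `(3,0)` at every other place (Landherr 1936; Scharlau, *Quadratic and
Hermitian Forms*, Ch. 10 — only the trivial EXISTENCE direction is needed and proved here; the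
classification direction is the separate stub `StubTree.lemma33b_landherr`).

Proof.  `h = ⟨1, 1, a⟩` with `a ∈ L⁺` negative at the place of `ι₁` and positive elsewhere
(`exists_neg_at_pos_off`).  The element `a`: if `L` has a single infinite place, `a = -1`; otherwise
Dirichlet's unit theorem (Mathlib `NumberField.Units.dirichletUnitTheorem.exists_unit`) gives a unit `u`
with `w u < 1` for every place `w ≠ w₁ := mk ι₁`, the product formula `∑_w mult_w log (w u) = 0`
(`NumberField.Units.sum_mult_mul_log`) forces `w₁ u > 1`, and `a := 1 - u ū ∈ L⁺` has
`τ a = 1 - ‖τ u‖² ∈ ℝ` of the required signs.  Sylvester at `ι₁` with `T = diag(1, 1, 1/√(-ι₁ a))`;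
positive definiteness elsewhere by `Matrix.PosDef.diagonal`.
-/

noncomputable section

open NumberField NumberField.InfinitePlace
open scoped ComplexOrder Matrix

namespace Summit.HodgeConjecture.CorCM

open Literature.NumberTheory.Automorphic (cmConjRingHom embedding_cmConjRingHom)

open Literature.AlgebraicGeometry.ShimuraVarieties


/-- **Landherr's existence theorem, rank 3, signature `(2,1), (3,0)^{g-1}`** — PROVED:
`h = diag(1, 1, a)` with `a` from `exists_neg_at_pos_off`. This closes the stub `StubTree.landherr_exists`
(Reduction.lean), which is now `:= landherr_exists_proof`. -/
theorem landherr_exists_proof : Universe.LandherrExists := by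
  intro L ι₁
  -- the arithmetic input is the tree's `Literature.NumberTheory.NumberFields.exists_neg_at_pos_off` (CMFieldPrescribedSigns)
  obtain ⟨a, ha', ⟨r, hr, hr0⟩, hpos⟩ := Literature.NumberTheory.NumberFields.exists_neg_at_pos_off (L := L) ι₁
  have ha : cmConjRingHom L a = a := ha'
  refine ⟨{ Hm := Matrix.diagonal ![1, 1, a], isHermitian := ?_, signature_ι₁ := ?_, posDef_of_ne := ?_ }⟩
  · intro i j
    fin_cases i <;> fin_cases j <;> simp [Matrix.diagonal, ha]
  · -- Sylvester at ι₁: `T = diag(1, 1, 1/√(-r))`, `Tᴴ · diag(1,1,r) · T = diag(1,1,-1) = signatureMatrix 2`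
    have hmap : (Matrix.diagonal ![(1 : L), 1, a]).map ι₁ = Matrix.diagonal ![(1 : ℂ), 1, (r : ℂ)] := by
      rw [Matrix.diagonal_map (map_zero ι₁)]
      congr 1; funext i; fin_cases i <;> simp [hr]
    set c : ℝ := (Real.sqrt (-r))⁻¹ with hc
    have hsq : Real.sqrt (-r) ^ 2 = -r := Real.sq_sqrt (by linarith)
    have hsqrt_pos : 0 < Real.sqrt (-r) := Real.sqrt_pos.mpr (by linarith)
    have hc0 : c ≠ 0 := inv_ne_zero hsqrt_pos.ne'
    have hcrc : (c : ℂ) * (r : ℂ) * (c : ℂ) = -1 := by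
      have : c * r * c = -1 := by
        rw [hc]; field_simp; nlinarith [hsq]
      exact_mod_cast this
    let T : Matrix (Fin 3) (Fin 3) ℂ := Matrix.diagonal ![(1 : ℂ), 1, (c : ℂ)]
    have hdet : T.det ≠ 0 := by
      simp [T, Matrix.det_diagonal, Fin.prod_univ_three, hc0]
    refine ⟨Matrix.GeneralLinearGroup.mkOfDetNeZero T hdet, ?_⟩
    rw [Matrix.GeneralLinearGroup.val_mkOfDetNeZero, hmap]
    simp only [T, Matrix.diagonal_conjTranspose, Matrix.diagonal_mul_diagonal]
    unfold signatureMatrix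
    congr 1; funext i
    fin_cases i <;> simp [Fin.last, hcrc]
  · intro τ hτ
    obtain ⟨s, hs, hs0⟩ := hpos τ hτ
    have hmap : (Matrix.diagonal ![(1 : L), 1, a]).map τ = Matrix.diagonal ![(1 : ℂ), 1, (s : ℂ)] := by
      rw [Matrix.diagonal_map (map_zero τ)]
      congr 1; funext i; fin_cases i <;> simp [hs]
    rw [hmap]
    apply Matrix.PosDef.diagonal
    intro i
    fin_cases i <;> simp [Complex.zero_lt_real, hs0]

end Summit.HodgeConjecture.CorCM

end
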